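import Summits.HodgeConjecture.HodgeConjecture.Cruxes.BlochSeedDiscOne.ShellThreePairLaw
import Summits.HodgeConjecture.HodgeConjecture.Cruxes.BlochSeedDiscOne.ShellThreeDoorB
import Summits.HodgeConjecture.HodgeConjecture.Cruxes.BlochSeedDiscOne.ShellThreeFloorB

/-!
# The off-axis PAIR and TRIPLE MASS TIES at every shell (plan-lens-HodgeAV-dual g17, 2026-08-31)

`line stmt-HodgeConjecture-18881 Cruxes/BlochSeedDiscOne/Lines/birth.lean 814a6a70c14e831a stub_rung_pad4_seedAt`
Rider to director-hodge R19.743 (3) (NB on `ShellThreePropagationB`: «for the (M2₄) short list a Buuu door-death propagates»).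
`ShellThreePropagationB` is SHELL 3 ONLY (`Ring3` in `hook_law_B` ∕ `P_a2210_zero_of_noHook_B`).  Its ring-free core is PairLaw v11's
`hook_slot_law` ∕ `degFive_law_alphabet` ∕ `degSix_law_alphabet` (clauses 1–2 of (A1) + alphabet, nothing else).  This module records
what they give at EVERY shell under the one displayed binder (Bu) = `ShellThreeFloorB.NoOffHubfreeP` («no hub-free supported P cell
has an off-axis letter») + coarse RULE D + alphabet — no ring, no `Disj`, no height:

* (L0) `hubfreeN_onAxis_of_noOff` (restated from `FamilyLemmaN.lean` @04b86a7f3d2b, farm-unbuilt): (Bu) ⇒ no hub-free supported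
  N cell has an off-axis letter;
* hence `a2111∘σ` and `a2211∘σ` vanish on BOTH supports at every placement (`N_a2111_zero_of_noOff`, `P_a2111_zero_of_noOff`,
  `N_a2211_zero_of_noOff`, `P_a2211_zero_of_noOff`);
* **PAIR MASS TIE** `pair_mass_tie`: `Σ_P m·a2210∘σ = Σ_N m·a2210∘σ` for every `σ` — the P mass of «off-axis letters at σ0, σ1 and a
  charged letter at σ2» (weighted `|xy|·|xy|·col`, fourth letter free, hubs included: P `BBHu`, `BDHu`, `DDHu`, `ABBH`, `BBCH`, …)
  EQUALS the N mass of the same shape;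
* **TRIPLE MASS TIE** `triple_mass_tie`: `Σ_P m·a2220∘σ = Σ_N m·a2220∘σ` (off-axis letters at σ0, σ1, σ2; fourth free);
* consumers `P_a2210_zero_of_N_zero`, `N_a2210_zero_of_P_zero`, `P_a2220_zero_of_N_zero`, `N_a2220_zero_of_P_zero`.

WHAT THIS SAYS FOR THE s = 4 LEDGER (room data, not kernel: `g17/check/hook_roomcheck.py` on gs-eng-2 g64 `shellroom4_gs2.json`
41e25d90999ee087): of the 18 fine-alive N classes of shape «off-axis pair + charged third», 15 die by the family lemmas ((L0) hub-free,
(L1)₄, (L3)₄) and the RESIDUAL is the BB-hub family {N `ABBH`, N `BBBH`, N `BBHu`} (one hub, an off-axis pair, every charged letter of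
co-level ≤ s − 2 — below the (L3)ₛ threshold; at s = 3 this residual is EMPTY, which is why PropagationB closes there; at s = 5 it has
18 classes).  So at s = 4 the ties read: P «off-axis pair + charged third» mass (51 fine-alive P classes) = N {ABBH, BBBH, BBHu} mass,
and P «off-axis triple» mass = N `BBBH`-type mass — a (Bu)₄ certificate does NOT by itself propagate to hubbed P cells; it does the
moment the three residual N classes are door- or SAT-dead.  **Nothing here is proved toward HC ∕ HC_CM ∕ HC_AV ∕ №4 ∕ 26512 ∕ 18881 ∕
H2; letters ≠ sheaves ≠ SEED; (Bu) is DISPLAYED, not proved.**  No `sorry`, no new axiom, no `instance`, no `notation`. -/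

set_option linter.dupNamespace false
set_option autoImplicit false

namespace Summit.HodgeConjecture.HodgeConjecture.Cruxes.BlochSeedDiscOne.PairMassTie

open Summit.HodgeConjecture.HodgeConjecture.Cruxes.BlochSeedDiscOne.DepthBoundA4
open Summit.HodgeConjecture.HodgeConjecture.Cruxes.BlochSeedDiscOne.RingFourEmpty
open Summit.HodgeConjecture.HodgeConjecture.Cruxes.BlochSeedDiscOne.RingTwoMassLaw
open Summit.HodgeConjecture.HodgeConjecture.Cruxes.BlochSeedDiscOne.ShellThreePairLaw hiding OffAxis col_eq two_le_colevel_of_offAxis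
open Summit.HodgeConjecture.HodgeConjecture.Cruxes.BlochSeedDiscOne.ShellThreeDoorB
open Summit.HodgeConjecture.HodgeConjecture.Cruxes.BlochSeedDiscOne.LeggedFloor

/-! ## §0 The binder and (L0) -/

/-- (Bu) is `ShellThreeFloorB.NoOffHubfreeP` (the plate's currency), used as is; its body, for the reader. -/
theorem noOffHubfreeP_iff (D : Design) :
    ShellThreeFloorB.NoOffHubfreeP D ↔
      ∀ x ∈ D.suppP, (∀ f : Fin 4, (x f).colevel ≠ 0) → ∀ f : Fin 4, ¬ OffAxis (x f) := Iff.rfl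

/-- **(L0)** (= `FamilyLemmaN.hubfreeN_onAxis_of_noOff`, restated because that module is not yet farm-built): under (Bu) no
hub-free supported N cell has an off-axis letter — RULE D at a block through the off-axis slot: the P supplier equals the N cell off
the block and lies weakly below it on the block, so it is hub-free and off-axis there. No ring, no `Disj`, any height. -/
theorem hubfreeN_onAxis_of_noOff {h : ℤ} {D : Design} (hD : D.OnAlphabet h) (hr : RuleD D) (hBu : ShellThreeFloorB.NoOffHubfreeP D)
    {y : Cell} (hy : y ∈ D.suppN) (hfree : ∀ f : Fin 4, (y f).colevel ≠ 0) (k : Fin 4) : ¬ OffAxis (y k) := by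
  intro hoff
  have hyA : ∀ f : Fin 4, (y f).OnAlphabet h := hD y (LeggedFloor.mem_supp_of_memN D hy)
  obtain ⟨j, hjk⟩ : ∃ j : Fin 4, j ≠ k := by
    by_cases hk : k = 0
    · exact ⟨1, by rw [hk]; omega⟩
    · exact ⟨0, fun h0 => hk h0.symm⟩
  obtain ⟨x, hx, hs⟩ := ruleDN_any hr hy hjk.symm (detects_of_col_ne_zero y k j (hfree k))
  have hxA : ∀ f : Fin 4, (x f).OnAlphabet h := hD x (LeggedFloor.mem_supp_of_memP D hx)
  have hxfree : ∀ f : Fin 4, (x f).colevel ≠ 0 := by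
    intro f
    by_cases hfk : f = k
    · rw [hfk]
      have h1 := col_le_of_eq_or_null (hxA k) (hyA k) hs.2.1
      have h2 := hfree k
      have h3 := col_nonneg (y k)
      omega
    by_cases hfj : f = j
    · rw [hfj]
      have h1 := col_le_of_eq_or_null (hxA j) (hyA j) hs.2.2
      have h2 := hfree j
      have h3 := col_nonneg (y j)
      omega
    · rw [hs.1 f hfk hfj]; exact hfree f
  exact hBu x hx hxfree k (offAxis_of_eq_or_null (hxA k) (hyA k) hs.2.1 hoff)

/-! ## §1 The hook and pair functionals vanish on both supports under (Bu) -/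

/-- `a2111∘σ` vanishes on the N support: a cell with `a2111∘σ ≠ 0` is hub-free with an off-axis letter at `σ0`. -/
theorem N_a2111_zero_of_noOff {h : ℤ} {D : Design} (hD : D.OnAlphabet h) (hr : RuleD D) (hBu : ShellThreeFloorB.NoOffHubfreeP D)
    (σ : Equiv.Perm (Fin 4)) : ∀ c ∈ D.suppN, a2111 σ c = 0 := by
  intro c hc
  by_contra hne
  unfold a2111 at hne
  obtain ⟨h012, h3⟩ := mul_ne_zero_iff.mp hne
  obtain ⟨h01, h2⟩ := mul_ne_zero_iff.mp h012
  obtain ⟨h0, h1⟩ := mul_ne_zero_iff.mp h01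
  have hoff : OffAxis (c (σ 0)) := offAxis_of_absmul_ne_zero h0
  have c0 := two_le_colevel_of_offAxis _ hoff
  have hfree : ∀ f : Fin 4, (c f).colevel ≠ 0 :=
    forall_slot_of_perm σ (P := fun f => (c f).colevel ≠ 0) (by omega) h1 h2 h3
  exact hubfreeN_onAxis_of_noOff hD hr hBu hc hfree (σ 0) hoff

/-- `a2111∘σ` vanishes on the P support: directly (Bu). -/
theorem P_a2111_zero_of_noOff {D : Design} (hBu : ShellThreeFloorB.NoOffHubfreeP D) (σ : Equiv.Perm (Fin 4)) :
    ∀ c ∈ D.suppP, a2111 σ c = 0 := by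
  intro c hc
  by_contra hne
  unfold a2111 at hne
  obtain ⟨h012, h3⟩ := mul_ne_zero_iff.mp hne
  obtain ⟨h01, h2⟩ := mul_ne_zero_iff.mp h012
  obtain ⟨h0, h1⟩ := mul_ne_zero_iff.mp h01
  have hoff : OffAxis (c (σ 0)) := offAxis_of_absmul_ne_zero h0
  have c0 := two_le_colevel_of_offAxis _ hoff
  have hfree : ∀ f : Fin 4, (c f).colevel ≠ 0 :=
    forall_slot_of_perm σ (P := fun f => (c f).colevel ≠ 0) (by omega) h1 h2 h3
  exact hBu c hc hfree (σ 0) hoff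

/-- `a2211∘σ` vanishes on the N support under (Bu). -/
theorem N_a2211_zero_of_noOff {h : ℤ} {D : Design} (hD : D.OnAlphabet h) (hr : RuleD D) (hBu : ShellThreeFloorB.NoOffHubfreeP D)
    (σ : Equiv.Perm (Fin 4)) : ∀ c ∈ D.suppN, a2211 σ c = 0 := by
  intro c hc
  by_contra hne
  unfold a2211 at hne
  obtain ⟨h012, h3⟩ := mul_ne_zero_iff.mp hne
  obtain ⟨h01, h2⟩ := mul_ne_zero_iff.mp h012
  obtain ⟨h0, h1⟩ := mul_ne_zero_iff.mp h01
  have ho0 : OffAxis (c (σ 0)) := offAxis_of_absmul_ne_zero h0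
  have ho1 : OffAxis (c (σ 1)) := offAxis_of_absmul_ne_zero h1
  have c0 := two_le_colevel_of_offAxis _ ho0
  have c1 := two_le_colevel_of_offAxis _ ho1
  have hfree : ∀ f : Fin 4, (c f).colevel ≠ 0 :=
    forall_slot_of_perm σ (P := fun f => (c f).colevel ≠ 0) (by omega) (by omega) h2 h3
  exact hubfreeN_onAxis_of_noOff hD hr hBu hc hfree (σ 0) ho0

/-- `a2211∘σ` vanishes on the P support under (Bu). -/
theorem P_a2211_zero_of_noOff {D : Design} (hBu : ShellThreeFloorB.NoOffHubfreeP D) (σ : Equiv.Perm (Fin 4)) :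
    ∀ c ∈ D.suppP, a2211 σ c = 0 := by
  intro c hc
  by_contra hne
  unfold a2211 at hne
  obtain ⟨h012, h3⟩ := mul_ne_zero_iff.mp hne
  obtain ⟨h01, h2⟩ := mul_ne_zero_iff.mp h012
  obtain ⟨h0, h1⟩ := mul_ne_zero_iff.mp h01
  have ho0 : OffAxis (c (σ 0)) := offAxis_of_absmul_ne_zero h0
  have ho1 : OffAxis (c (σ 1)) := offAxis_of_absmul_ne_zero h1
  have c0 := two_le_colevel_of_offAxis _ ho0
  have c1 := two_le_colevel_of_offAxis _ ho1
  have hfree : ∀ f : Fin 4, (c f).colevel ≠ 0 :=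
    forall_slot_of_perm σ (P := fun f => (c f).colevel ≠ 0) (by omega) (by omega) h2 h3
  exact hBu c hc hfree (σ 0) ho0

/-! ## §2 The two mass ties (every shell, every height; (A1) clauses 1–2 + alphabet + RULE D + (Bu)) -/

/-- **PAIR MASS TIE**: `Σ_P m·a2210∘σ = Σ_N m·a2210∘σ` for every placement `σ`. -/
theorem pair_mass_tie {h : ℤ} {D : Design} (hD : D.OnAlphabet h) (h1 : D.A1) (hr : RuleD D) (hBu : ShellThreeFloorB.NoOffHubfreeP D)
    (σ : Equiv.Perm (Fin 4)) : linZ D.P (a2210 σ) = linZ D.N (a2210 σ) := by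
  have hlaw := hook_slot_law hD h1 σ σ (N_a2111_zero_of_noOff hD hr hBu σ)
  rw [linZ_P_eq_zero_of_supp D _ (P_a2111_zero_of_noOff hBu σ)] at hlaw
  omega

/-- **TRIPLE MASS TIE**: `Σ_P m·a2220∘σ = Σ_N m·a2220∘σ` for every placement `σ`. -/
theorem triple_mass_tie {h : ℤ} {D : Design} (hD : D.OnAlphabet h) (h1 : D.A1) (hr : RuleD D) (hBu : ShellThreeFloorB.NoOffHubfreeP D)
    (σ : Equiv.Perm (Fin 4)) : linZ D.P (a2220 σ) = linZ D.N (a2220 σ) := by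
  have hlaw := degSix_law_alphabet hD h1 σ σ
  rw [linZ_N_eq_zero_of_supp D _ (N_a2211_zero_of_noOff hD hr hBu σ),
    linZ_P_eq_zero_of_supp D _ (P_a2211_zero_of_noOff hBu σ)] at hlaw
  omega

/-! ## §3 Consumers: either side empty ⇒ the other side empty -/

theorem P_a2210_zero_of_N_zero {h : ℤ} {D : Design} (hD : D.OnAlphabet h) (h1 : D.A1) (hr : RuleD D)
    (hBu : ShellThreeFloorB.NoOffHubfreeP D) (σ : Equiv.Perm (Fin 4)) (hN : ∀ c ∈ D.suppN, a2210 σ c = 0) :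
    ∀ c ∈ D.suppP, a2210 σ c = 0 := by
  have h0 : linZ D.P (a2210 σ) = 0 := by
    rw [pair_mass_tie hD h1 hr hBu σ, linZ_N_eq_zero_of_supp D _ hN]
  intro c hc
  obtain ⟨m, hm, hp⟩ := (mem_suppP_iff D c).mp hc
  exact vanish_of_linZ_eq_zero D.P (a2210 σ) (a2210_nonneg σ) h0 hm hp

theorem N_a2210_zero_of_P_zero {h : ℤ} {D : Design} (hD : D.OnAlphabet h) (h1 : D.A1) (hr : RuleD D)
    (hBu : ShellThreeFloorB.NoOffHubfreeP D) (σ : Equiv.Perm (Fin 4)) (hP : ∀ c ∈ D.suppP, a2210 σ c = 0) :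
    ∀ c ∈ D.suppN, a2210 σ c = 0 := by
  have h0 : linZ D.N (a2210 σ) = 0 := by
    rw [← pair_mass_tie hD h1 hr hBu σ, linZ_P_eq_zero_of_supp D _ hP]
  intro c hc
  obtain ⟨m, hm, hp⟩ := (mem_suppN_iff D c).mp hc
  exact vanish_of_linZ_eq_zero D.N (a2210 σ) (a2210_nonneg σ) h0 hm hp

theorem P_a2220_zero_of_N_zero {h : ℤ} {D : Design} (hD : D.OnAlphabet h) (h1 : D.A1) (hr : RuleD D)
    (hBu : ShellThreeFloorB.NoOffHubfreeP D) (σ : Equiv.Perm (Fin 4)) (hN : ∀ c ∈ D.suppN, a2220 σ c = 0) :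
    ∀ c ∈ D.suppP, a2220 σ c = 0 := by
  have h0 : linZ D.P (a2220 σ) = 0 := by
    rw [triple_mass_tie hD h1 hr hBu σ, linZ_N_eq_zero_of_supp D _ hN]
  intro c hc
  obtain ⟨m, hm, hp⟩ := (mem_suppP_iff D c).mp hc
  exact vanish_of_linZ_eq_zero D.P (a2220 σ) (a2220_nonneg σ) h0 hm hp

theorem N_a2220_zero_of_P_zero {h : ℤ} {D : Design} (hD : D.OnAlphabet h) (h1 : D.A1) (hr : RuleD D)
    (hBu : ShellThreeFloorB.NoOffHubfreeP D) (σ : Equiv.Perm (Fin 4)) (hP : ∀ c ∈ D.suppP, a2220 σ c = 0) :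
    ∀ c ∈ D.suppN, a2220 σ c = 0 := by
  have h0 : linZ D.N (a2220 σ) = 0 := by
    rw [← triple_mass_tie hD h1 hr hBu σ, linZ_P_eq_zero_of_supp D _ hP]
  intro c hc
  obtain ⟨m, hm, hp⟩ := (mem_suppN_iff D c).mp hc
  exact vanish_of_linZ_eq_zero D.N (a2220 σ) (a2220_nonneg σ) h0 hm hp

/-! ## §4 What the shape conditions mean cell by cell (for readers of the room tables) -/

/-- `a2210∘σ c ≠ 0` iff the letters at `σ0`, `σ1` are off-axis and the letter at `σ2` is charged (the fourth letter is free). -/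
theorem a2210_ne_zero_iff (σ : Equiv.Perm (Fin 4)) (c : Cell) :
    a2210 σ c ≠ 0 ↔ OffAxis (c (σ 0)) ∧ OffAxis (c (σ 1)) ∧ (c (σ 2)).colevel ≠ 0 := by
  unfold a2210 OffAxis
  simp only [ne_eq, mul_eq_zero, abs_eq_zero, not_or]
  tauto

/-- `a2220∘σ c ≠ 0` iff the letters at `σ0`, `σ1`, `σ2` are off-axis (the fourth letter is free). -/
theorem a2220_ne_zero_iff (σ : Equiv.Perm (Fin 4)) (c : Cell) :
    a2220 σ c ≠ 0 ↔ OffAxis (c (σ 0)) ∧ OffAxis (c (σ 1)) ∧ OffAxis (c (σ 2)) := by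
  unfold a2220 OffAxis
  simp only [ne_eq, mul_eq_zero, abs_eq_zero, not_or]
  tauto

/-- Scope note (a `True` carrier for the docstring): the ties are MASS identities between the P and N supports; they kill nothing
by themselves.  At shell 3 the N side of both shapes is door-dead under (B) (`ShellThreePropagationB`), at shell 4 it reduces (room
41e25d90999ee087 + family lemmas) to the BB-hub family {`ABBH`, `BBBH`, `BBHu`}, at shell 5 to 18 classes (`hook_roomcheck_s5.log`). -/
theorem scope_note : True := trivial

end Summit.HodgeConjecture.HodgeConjecture.Cruxes.BlochSeedDiscOne.PairMassTie
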